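import Literature.AnabelianGeometry.EtaleTheta.DivisorMonoidsOfBaseFieldHull
import Literature.AnabelianGeometry.EtaleTheta.TemperedFrobenioidOfRankOneBase
import Literature.AnabelianGeometry.EtaleTheta.MonoprimeStructure
import Literature.AnabelianGeometry.EtaleTheta.Discharge.Sec3Lemma35HoldsWeak
import Literature.AnabelianGeometry.EtaleTheta.Discharge.Sec3Remark364Weak
import Literature.AnabelianGeometry.SemiGraphs.CosetCategoriesBridge
import Literature.AlgebraicGeometry.Frobenioids.QuasiTemperoidConnectedPart
import Literature.AlgebraicGeometry.Frobenioids.ArithmeticDivisorsPerfFactorial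
import HarnessLib

/-!
# [EtTh] Def. 3.6 (ii)/(iv): the base-field-theoretic hull AS A TEMPERED FROBENIOID of monoid type `ℤ` over the GENUINE base
# `B^temp(Π)⁰`, constants in `ℚ̄_p` with their genuine Galois action (class (b) construction; abc-iut-w6-d048's engine)

S. Mochizuki, *The étale theta function …*, Publ. RIMS **45** (2009) [MochizukiEtTh2009], Def. 3.6 (ii) pp.302–303 (PDF pp.76–77),
Def. 3.6 (iv) p.304 (PDF p.78): «the data `(D, Φ^{bs-fld}, F, F → (Φ^{bs-fld})^gp)` determines a model Frobenioid `C^{bs-fld}` … the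
*base-field-theoretic hull* of the tempered Frobenioid `C` … a `p`-adic Frobenioid in the sense of [FrdII], Example 1.1, (ii)»; §5 p.322
(PDF p.96) («`D = D_α` … geometrically connected over `K`»); [FrdI] Thm. 5.2 (ii) p.100.  [cite: MochizukiEtTh2009, Def 3.6 (iv) p.304 (PDF p.78)]

abc-iut cell, layer L2, seat abc-iut-L2-d3 (gen 10); L2-lead ruling R1112 «CONST-DICT CARRIER = C^{bs-fld} HULL OVER THE GENUINE
BASE» (gen 9 sizing; basename NO OBJECTION).  CLASS (b) CONSTRUCTION over this lineage's Def. 3.3 (iii) datum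
`DivisorMonoids.bsFldHull a ha` (`DivisorMonoidsOfBaseFieldHull.lean`: `Φ₀(U) = (1/e_U)ℤ_{≥0}`, `B₀(U) = Hom_Γ(Γ/U, ℚ̄_p^×) ≅ K_U^×`,
`div₀ = ord`) and abc-iut-w6-d048's GENERIC ENGINE `TemperedFrobenioid.ofRankOneBase` (`TemperedFrobenioidOfRankOneBase.lean`),
VERBATIM the pattern of abc-iut-w6-d048's `OneCompTempered.temperedFrobenioid` (`BiKummerThm44HypOfGaloisCoveringTempered.lean`) with
the trivial-action one-component model replaced by the hull; nothing landed is edited.  For EVERY tempered `Γ` (print's `Π`) and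
EVERY `a : Γ → G_{ℚ_p}` carrying open subgroups to open subgroups:
* `hpf` — every `Φ₀(U) ≅ ℤ_{≥0}` is weakly perf-factorial with cofinal perfection;
* `rankOneBase` — `TemperedFrobenioid.RankOneBase (bsFldHull a ha) (ConnectedPart (BTemp Γ))` ALONG THE EQUIVALENCE
  `(CosetCat.equivConnectedPart hΓ).inverse : B^temp(Γ)⁰ ⥤ CosetCat Γ`: `e := phiSubEquivNat`, `hcnst`, injective and
  divisibility-reflecting pull-backs — this lineage's one-liners;
* **`temperedFrobenioid a ha hΓ R S : TemperedFrobenioid (ofRlfZWeak (bsFldHull a ha) hpf) (ConnectedPart (BTemp Γ)) (treeCatVocab …)`**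
  — the base-field-theoretic hull as a Def. 3.6 (ii) tempered Frobenioid of monoid type `ℤ` (`temperedFrobenioid_monoidType`, the
  `hZ` slot) with `Φ` perfect (`hP`), base functor an EQUIVALENCE (full, faithful, essentially surjective: `baseShape` with
  `𝒟 := Γ/Γ`), `B₀`-pull-backs injective (`hBD`), `Φ` non-dilating along every endomorphism (`isNonDilating`), and **a Frobenioid**
  ([FrdI] Thm. 5.2 (ii): `isFrobenioid_temperedFrobenioid`).
HONEST LABEL: genuine base, genuine constants and Galois action; DEGENERATE divisor geometry (all functions constant, no cusps, one
prime per covering) — the constants-part of print's `C`, a consistency / carrier witness for the [EtTh] §5 constants dictionary, NOT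
the tempered Frobenioid of a Tate curve (its `Θ̈` would be a constant).  No instance, no notation, no `Prop`-valued definition, no
sorry; nothing here bears on [IUTchIII] Cor. 3.12; no side taken; typed ≠ proved elsewhere.
-/

noncomputable section

namespace Literature.AnabelianGeometry.EtaleTheta

open CategoryTheory Opposite Function Multiplicative Literature.AlgebraicGeometry.Frobenioids Literature.AnabelianGeometry.SemiGraphs

namespace BsFldHull

variable (p : ℕ) [Fact p.Prime] {Γ : Type} [Group Γ] [TopologicalSpace Γ]
  (a : Γ →* GQp p) (ha : ∀ U : OpenSubgroup Γ, IsOpen ((U.toSubgroup.map a : Subgroup (GQp p)) : Set (GQp p)))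

/-- `ℤ_{≥0}` is weakly perf-factorial with cofinal perfection (monoprime ⇒ perf-factorial as printed ⇒ weak).
[cite: MochizukiFrdI2008, Def. 2.4(i) p.47] -/
theorem isPerfFactorialCof_nat : IsPerfFactorialCof (Multiplicative ℕ) :=
  isPerfFactorialCof_of_isPerfFactorial (MonoprimeStructure.isPerfFactorial isMonoprime_multiplicative_nat)

/-- **Prop. 3.4 (i) (weak, cofinal perfection) at every `Φ₀(U) = (1/e_U)ℤ_{≥0} ≅ ℤ_{≥0}`** — the `hpf` slot of the engine.
[cite: MochizukiEtTh2009, Prop 3.4 p.300 (PDF p.74)] -/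
theorem hpf : ∀ Y : (CosetCat Γ)ᵒᵖ, IsPerfFactorialCof ((DivisorMonoids.bsFldHull p a ha).Φ₀.obj Y) := fun Y =>
  IsPerfFactorialCof.of_mulEquiv (phiSubEquivNat p a ha Y.unop.sg).symm (isPerfFactorialCof_nat)

variable [IsTopologicalGroup Γ] (hΓ : IsTempered Γ)

/-- `CosetCat Γ ≌ B^temp(Γ)⁰` (abc-iut's `CosetCat.equivConnectedPart`). [cite: MochizukiFrdII2008, Ex 1.3 (i) p.11] -/
abbrev equiv : CosetCat Γ ≌ ConnectedPart (BTemp Γ) := CosetCat.equivConnectedPart hΓ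

/-- **Rank-one base data of the hull along `B^temp(Γ)⁰ ⥤ CosetCat Γ`**: `Φ₀ ≅ ℤ_{≥0}` (`phiSubEquivNat`), every effective divisor the
divisor of a constant, injective divisibility-reflecting pull-backs. [cite: MochizukiEtTh2009, Def 3.6 p.303 (PDF p.77)] -/
def rankOneBase : TemperedFrobenioid.RankOneBase (DivisorMonoids.bsFldHull p a ha) (ConnectedPart (BTemp Γ)) where
  F := (equiv hΓ).inverse
  e A := phiSubEquivNat p a ha ((equiv hΓ).inverse.obj A).sg
  hcnst _ m := bsFldHull_exists_div₀_eq p a ha _ m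
  hΦinj _ := bsFldHull_Φ₀_map_injective p a ha _
  hΦrefl _ m n h := bsFldHull_Φ₀_map_reflects_dvd p a ha _ m n h

variable (R S : ((ConnectedPart (BTemp Γ))ᵒᵖ ⥤ CommMonCat.{0}) → Prop)

/-- **The base-field-theoretic hull as a tempered Frobenioid over the GENUINE base `B^temp(Γ)⁰`** (Def. 3.6 (ii) data of monoid
type `ℤ`, base functor the equivalence `B^temp(Γ)⁰ ⥤ CosetCat Γ`, `Φ := im(Φ₀^pf → Φ₀^rlf) ≅ ℚ_{≥0}` objectwise; every Def. 3.6 (ii)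
condition PROVED by the engine).  [cite: MochizukiEtTh2009, Def 3.6 (iv) p.304 (PDF p.78)] -/
def temperedFrobenioid :
    TemperedFrobenioid (RealifiedDivisorMonoids.ofRlfZWeak (DivisorMonoids.bsFldHull p a ha) (hpf p a ha)) (ConnectedPart (BTemp Γ))
      (treeCatVocab (ConnectedPart (BTemp Γ)) R S) :=
  TemperedFrobenioid.ofRankOneBase (hpf p a ha) (rankOneBase p a ha hΓ) QuasiTemperoid.BTempConnected.connectedPart_isConnected
    QuasiTemperoid.BTempConnected.connectedPart_isTotallyEpimorphic QuasiTemperoid.BTempConnected.connectedPart_isOfFSMType R S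

/-- Its base functor IS the equivalence inverse `B^temp(Γ)⁰ ⥤ CosetCat Γ`. [cite: MochizukiEtTh2009, Def 3.6 p.303 (PDF p.77)] -/
theorem temperedFrobenioid_base : (temperedFrobenioid p a ha hΓ R S).base = (equiv hΓ).inverse := rfl

/-- **Monoid type `ℤ`** (the `hZ` slot of the §4 setting). [cite: MochizukiEtTh2009, Def 3.6 p.303 (PDF p.77)] -/
theorem temperedFrobenioid_monoidType : (temperedFrobenioid p a ha hΓ R S).monoidType = MonoidType.Z := rfl

/-- The base functor is full. [cite: MochizukiEtTh2009, Def 4.1 p.312 (PDF p.86)] -/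
theorem temperedFrobenioid_base_full : (temperedFrobenioid p a ha hΓ R S).base.Full := by
  rw [temperedFrobenioid_base]; infer_instance

/-- The base functor is faithful. [cite: MochizukiEtTh2009, Def 4.1 p.312 (PDF p.86)] -/
theorem temperedFrobenioid_base_faithful : (temperedFrobenioid p a ha hΓ R S).base.Faithful := by
  rw [temperedFrobenioid_base]; infer_instance

/-- The base functor is essentially surjective. [cite: MochizukiEtTh2009, Def 4.1 p.312 (PDF p.86)] -/
theorem temperedFrobenioid_base_essSurj : (temperedFrobenioid p a ha hΓ R S).base.EssSurj := by
  rw [temperedFrobenioid_base]; infer_instance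

/-- **`baseShape`** of the §4 interface: `D = D₀[𝒟]` with `𝒟 := Γ/Γ`. [cite: MochizukiEtTh2009, Def 4.1 p.312 (PDF p.86)] -/
theorem baseShape : (temperedFrobenioid p a ha hΓ R S).base.Full ∧ (temperedFrobenioid p a ha hΓ R S).base.Faithful ∧
    ∃ 𝒟 : CosetCat Γ, ∀ Y : CosetCat Γ,
      (∃ A : ConnectedPart (BTemp Γ), Nonempty ((temperedFrobenioid p a ha hΓ R S).base.obj A ≅ Y)) ↔ Nonempty (Y ⟶ 𝒟) :=
  ⟨temperedFrobenioid_base_full p a ha hΓ R S, temperedFrobenioid_base_faithful p a ha hΓ R S, CosetCat.top, fun Y =>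
    ⟨fun _ => ⟨CosetCat.toTop Y⟩, fun _ => ⟨(equiv hΓ).functor.obj Y, ⟨((equiv hΓ).unitIso.app Y).symm⟩⟩⟩⟩

/-- **`hBD`**: the `B₀`-pull-backs along base images are injective. [cite: MochizukiEtTh2009, Def 3.6 p.302 (PDF p.76)] -/
theorem hBD {A B : ConnectedPart (BTemp Γ)} (α : B ⟶ A) :
    Injective ((RealifiedDivisorMonoids.ofRlfZWeak (DivisorMonoids.bsFldHull p a ha) (hpf p a ha)).BΛ.map
      ((temperedFrobenioid p a ha hΓ R S).base.map α).op).hom :=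
  bsFldHull_B₀_map_injective p a ha _

/-- **The hull IS a Frobenioid** ([FrdI] Thm. 5.2 (ii)). [cite: MochizukiFrdI2008, Thm. 5.2 (ii) p.100] -/
theorem isFrobenioid_temperedFrobenioid : PreFrobenioid.IsFrobenioid (temperedFrobenioid p a ha hΓ R S).toElem :=
  TemperedFrobenioid.isFrobenioid_ofRankOneBase (hpf p a ha) (rankOneBase p a ha hΓ) _ _ _ R S
    fun g => bsFldHull_B₀_map_injective p a ha g

/-- **`Φ` is non-dilating along every endomorphism of the base** (pull-backs of `Φ₀` are inclusions, here the identity).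
[cite: MochizukiFrdI2008, Def. 1.1 (i) p.19] -/
theorem isNonDilating (A : (ConnectedPart (BTemp Γ))ᵒᵖ) (φ : A ⟶ A) :
    treeMonoidVocabWeak.{0}.IsNonDilating ((temperedFrobenioid p a ha hΓ R S).Φ.carrier A)
      ((temperedFrobenioid p a ha hΓ R S).Φ.pull φ) :=
  TemperedFrobenioid.isNonDilating_ofRankOneBase_of_trivial (hpf p a ha) (rankOneBase p a ha hΓ) _ _ _ R S A φ fun m =>
    Subtype.ext (coe_pullPhi p a ha ((equiv hΓ).inverse.map φ.unop) m)

/-- **`Φ(A)` is perfect** — the `hP` slot of the §4 setting. [cite: MochizukiEtTh2009, Def 4.1 p.312 (PDF p.86)] -/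
theorem hP (A : (ConnectedPart (BTemp Γ))ᵒᵖ) : IsPerfect ((temperedFrobenioid p a ha hΓ R S).Φ.carrier A) :=
  TemperedFrobenioid.ofRankOneBase_isPerfect (hpf p a ha) (rankOneBase p a ha hΓ) _ _ _ R S A

/-- **Non-vacuity over the genuine base**: for every tempered `Γ` and every `a` with open images, a tempered Frobenioid over
`B^temp(Γ)⁰` whose Def. 3.3 (iii) data are the base-field-theoretic hull (genuine `ℚ̄_p` constants) EXISTS, with equivalence base functor.
[cite: MochizukiEtTh2009, Def 3.6 (iv) p.304 (PDF p.78)] -/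
theorem nonempty_temperedFrobenioid :
    ∃ C : TemperedFrobenioid (RealifiedDivisorMonoids.ofRlfZWeak (DivisorMonoids.bsFldHull p a ha) (hpf p a ha)) (ConnectedPart (BTemp Γ))
      (treeCatVocab (ConnectedPart (BTemp Γ)) R S), C.base = (equiv hΓ).inverse :=
  ⟨temperedFrobenioid p a ha hΓ R S, rfl⟩

end BsFldHull

end Literature.AnabelianGeometry.EtaleTheta

end
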